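import Summits.CriticalPhenomena.CardyFormulaZ2.Theorems.CardyMagicRigidityMarkovCascadeDefs
import Literature.Probability.RandomPlanarGeometry.LoopConfigurationsMetric
import HarnessLib

/-!
# Applying `KernelTransfer` to the hole families of the cascade: translated families and uniformity
# (helper toward stub `stub_cascadeReconstruction`, line `markov-cascade-one-generation`, crux `NestingRigidity`)

Route `CardyMagicRigidity` (sub-problem `CriticalPhenomena/CardyFormulaZ2`), crux
`Summit.CriticalPhenomena.CardyFormulaZ2.Theses.CardyMagicRigidity.NestingRigidity`
(stmt-CriticalPhenomena-4835), line `markov-cascade-one-generation` (vocabulary: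
`Theorems/CardyMagicRigidityMarkovCascadeDefs.lean`).  `KernelTransfer` — the hypothesis of
`stub_cascadeReconstruction : KernelTransfer → DomainLawTransfer` — merges the first-generation kernels of
the closed-b.c. bond-`ℤ²` and site-`𝕋` ensembles POINTWISE along every loop family `u_δ → u` with
two-sided limit, in the holes `holeOf (u_δ)`.  The cascade consumes it in two derived forms, both proved
here sorry-free and without any input beyond the vocabulary:

* **translated families** (`kernelTransfer_translate`, registered helper): the class of admissible hole
  families is closed under convergent translations `b_δ → b` — winding numbers, winding interiors, traces
  and two-sidedness are translation covariant (`wind_map_translate`, `holeOf_map_translate`,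
  `range_map_translate`, `TwoSided.map_translate`) and translation is jointly continuous in the loop metric
  of `d_CN` (`dist_map_translate_le`, `tendsto_map_translate`); this is how the half-mesh shift
  `-δ(1+i)/2` of the planar self-duality of bond-`ℤ²` is "absorbed by the families";
* **uniformity** (`kernelTransfer_uniform`, registered helper; pure logic, "continuous convergence ⇒
  uniform convergence on compacta"): over sets of holes `A δ` that are asymptotically precompact with
  two-sided limit points, the first-generation merging holds UNIFORMLY — the form in which it is applied
  to the random holes of generation `n` (precompactness and two-sidedness of the lattice holes being the
  Aizenman–Burchard / arm-event inputs of the stub, not proved here).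
-/

noncomputable section

open MeasureTheory Set Filter Metric
open scoped Topology BigOperators ENNReal Real

namespace Summit.CriticalPhenomena.CardyFormulaZ2.Cruxes.NestingRigidity.MarkovCascadeOneGeneration

open Literature.Probability.RandomPlanarGeometry Literature.Probability.Percolation
  Literature.Probability.LatticeModels
open Summit.CriticalPhenomena.CardyFormulaZ2.Theses.CardyMagicRigidity

/-! ### Translated loop families are admissible for `KernelTransfer` -/

/-- The translation `w ↦ w + b` of the plane as a continuous map (written `1 * w + b`, the affine form
of `CurveClass.wind_map_affine`). -/
theorem continuous_translate (b : ℂ) : Continuous fun w : ℂ ↦ 1 * w + b := by fun_prop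

/-- Translations are isometries. -/
theorem isometry_translate (b : ℂ) : Isometry fun w : ℂ ↦ 1 * w + b :=
  Isometry.of_dist_eq fun x y ↦ by simp [dist_eq_norm]

/-- **Winding numbers are translation invariant**: `W(u + b, z + b) = W(u, z)`. -/
theorem wind_map_translate (u : UnbasedLoop ℂ) (b z : ℂ) :
    (u.map ⟨fun w ↦ 1 * w + b, continuous_translate b⟩ (isometry_translate b)).wind (z + b) = u.wind z := by
  obtain ⟨⟨c, hc⟩, rfl⟩ := UnbasedLoop.mk_surjective u
  rw [UnbasedLoop.map_mk, UnbasedLoop.wind_mk, UnbasedLoop.wind_mk]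
  have := CurveClass.wind_map_affine c one_ne_zero b z
  rw [one_mul] at this
  exact this

/-- **The winding interior of a translated loop is the translated winding interior.** -/
theorem holeOf_map_translate (u : UnbasedLoop ℂ) (b : ℂ) :
    holeOf (u.map ⟨fun w ↦ 1 * w + b, continuous_translate b⟩ (isometry_translate b)) =
      (fun z ↦ z + b) '' holeOf u := by
  ext z
  simp only [holeOf, mem_setOf_eq, mem_image]
  constructor
  · intro h
    refine ⟨z - b, ?_, sub_add_cancel z b⟩
    rwa [← wind_map_translate u b (z - b), sub_add_cancel]
  · rintro ⟨w, hw, rfl⟩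
    rwa [wind_map_translate]

/-- The trace of a translated loop is the translated trace. -/
theorem range_map_translate (u : UnbasedLoop ℂ) (b : ℂ) :
    (u.map ⟨fun w ↦ 1 * w + b, continuous_translate b⟩ (isometry_translate b)).range =
      (fun z ↦ z + b) '' u.range := by
  rw [UnbasedLoop.range_map]
  congr 1
  funext w
  simp

/-- **Two-sidedness is translation invariant** (a translation is a homeomorphism commuting with
winding interiors, traces and closures). -/
theorem TwoSided.map_translate {u : UnbasedLoop ℂ} (hu : TwoSided u) (b : ℂ) :
    TwoSided (u.map ⟨fun w ↦ 1 * w + b, continuous_translate b⟩ (isometry_translate b)) := by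
  have hcl : ∀ S : Set ℂ, (fun z ↦ z + b) '' closure S = closure ((fun z ↦ z + b) '' S) := fun S ↦ by
    simpa using (Homeomorph.addRight b).image_closure S
  refine ⟨?_, ?_⟩
  · rw [holeOf_map_translate, range_map_translate, ← hcl]
    exact Set.image_mono hu.1
  · rw [range_map_translate]
    refine (Set.image_mono hu.2).trans ?_
    rw [hcl]
    refine closure_mono ?_
    rintro _ ⟨w, ⟨hw0, hwr⟩, rfl⟩
    refine ⟨by rw [wind_map_translate]; exact hw0, fun hmem ↦ hwr ?_⟩
    obtain ⟨w', hw', heq⟩ := hmem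
    dsimp only at heq
    rw [add_left_inj] at heq
    rwa [← heq]

/-- Translating by `b` and by `b'` moves a loop by at most `dist b b'` in the loop metric of `d_CN`
(the identity matching of parametrisations). -/
theorem dist_map_translate_le (u : UnbasedLoop ℂ) (b b' : ℂ) :
    dist (u.map ⟨fun w ↦ 1 * w + b, continuous_translate b⟩ (isometry_translate b))
      (u.map ⟨fun w ↦ 1 * w + b', continuous_translate b'⟩ (isometry_translate b')) ≤ dist b b' := by
  obtain ⟨⟨c, hc⟩, rfl⟩ := UnbasedLoop.mk_surjective u
  obtain ⟨γ, rfl⟩ := CurveClass.surjective_mk c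
  rw [UnbasedLoop.map_mk, UnbasedLoop.map_mk, UnbasedLoop.dist_mk_mk]
  refine (BasedLoop.dist_le_dist_toCurveClass _ _).trans ?_
  change dist ((CurveClass.mk γ).map _) ((CurveClass.mk γ).map _) ≤ _
  rw [CurveClass.map_mk, CurveClass.map_mk, CurveClass.mk_eq_separationQuotientMk,
    SeparationQuotient.dist_mk]
  refine (Curve.dist_le_dist_toContinuousMap _ _).trans ?_
  refine (ContinuousMap.dist_le dist_nonneg).2 fun t ↦ ?_
  change dist (1 * γ t + b) (1 * γ t + b') ≤ dist b b'
  simp [dist_eq_norm]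

/-- **Convergent families stay convergent under convergent translations**: if `u_i → u` and
`b_i → b` then `u_i + b_i → u + b` in the loop metric of `d_CN`. -/
theorem tendsto_map_translate {ι : Type*} {l : Filter ι} {us : ι → UnbasedLoop ℂ} {u : UnbasedLoop ℂ}
    {bs : ι → ℂ} {b : ℂ} (hu : Tendsto us l (𝓝 u)) (hb : Tendsto bs l (𝓝 b)) :
    Tendsto (fun i ↦ (us i).map ⟨fun w ↦ 1 * w + bs i, continuous_translate (bs i)⟩
      (isometry_translate (bs i))) l
      (𝓝 (u.map ⟨fun w ↦ 1 * w + b, continuous_translate b⟩ (isometry_translate b))) := by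
  rw [tendsto_iff_dist_tendsto_zero]
  have h0 : Tendsto (fun i ↦ dist (us i) u + dist (bs i) b) l (𝓝 0) := by
    simpa using (tendsto_iff_dist_tendsto_zero.1 hu).add (tendsto_iff_dist_tendsto_zero.1 hb)
  refine squeeze_zero (fun _ ↦ dist_nonneg) (fun i ↦ ?_) h0
  calc dist ((us i).map ⟨fun w ↦ 1 * w + bs i, continuous_translate (bs i)⟩ (isometry_translate (bs i)))
        (u.map ⟨fun w ↦ 1 * w + b, continuous_translate b⟩ (isometry_translate b))
      ≤ dist ((us i).map ⟨fun w ↦ 1 * w + bs i, continuous_translate (bs i)⟩ (isometry_translate (bs i)))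
          (u.map ⟨fun w ↦ 1 * w + bs i, continuous_translate (bs i)⟩ (isometry_translate (bs i))) +
        dist (u.map ⟨fun w ↦ 1 * w + bs i, continuous_translate (bs i)⟩ (isometry_translate (bs i)))
          (u.map ⟨fun w ↦ 1 * w + b, continuous_translate b⟩ (isometry_translate b)) :=
        dist_triangle _ _ _
    _ ≤ dist (us i) u + dist (bs i) b := by
        rw [UnbasedLoop.dist_map_map]
        exact add_le_add le_rfl (dist_map_translate_le u _ _)

/-- **`KernelTransfer` along translated families.** If `u_δ → u` with `u` two-sided and `b_δ → b`, then
the first-generation laws of the two closed-b.c. ensembles in the TRANSLATED holes `holeOf (u_δ) + b_δ`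
merge in `d_CN` as `δ → 0⁺`: the class of admissible hole families is closed under convergent
translations (e.g. the half-mesh shifts `b_δ = -δ(1+i)/2` of the planar-duality step on `ℤ²`, applied
to the random holes of the cascade). -/
theorem kernelTransfer_translate : KernelTransfer → ∀ (u : UnbasedLoop ℂ) (uδ : ℝ → UnbasedLoop ℂ)
    (b : ℂ) (bδ : ℝ → ℂ), TwoSided u → Tendsto uδ (𝓝[>] 0) (𝓝 u) → Tendsto bδ (𝓝[>] 0) (𝓝 b) →
    Tendsto (fun δ : ℝ ↦ LoopConfig.cnLawEDist P2
      (fun ω ↦ firstGen (domLoopsZ2 ((fun z ↦ z + bδ δ) '' holeOf (uδ δ)) δ ω))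
      PT (fun ω ↦ firstGen (domLoopsT ((fun z ↦ z + bδ δ) '' holeOf (uδ δ)) δ ω))) (𝓝[>] 0) (𝓝 0) := by
  intro hK u uδ b bδ hu huδ hb
  have h := hK _ _ (hu.map_translate b) (tendsto_map_translate huδ hb)
  simpa only [holeOf_map_translate] using h

/-! ### Uniformity of `KernelTransfer` over precompact families of holes

`KernelTransfer` is stated POINTWISE in the loop family `u_δ → u`; the cascade applies it to the random
holes of generation `n`, i.e. needs it UNIFORMLY over sets `A δ` of holes that are asymptotically
precompact with two-sided limit points (for the lattice holes: Aizenman–Burchard tightness and a.s.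
two-sidedness of subsequential limits — inputs of the stub, not proved here).  The upgrade itself is pure
logic ("continuous convergence ⇒ uniform convergence on compacta") and is proved now. -/

/-- Along `δ → 0⁺`, eventually `δ` avoids any given real number. -/
theorem eventually_nhdsGT_zero_ne (a : ℝ) : ∀ᶠ δ in 𝓝[>] (0 : ℝ), δ ≠ a := by
  by_cases ha : 0 < a
  · filter_upwards [mem_nhdsWithin_of_mem_nhds (Iio_mem_nhds ha)] with δ hδ
    exact ne_of_lt hδ
  · filter_upwards [self_mem_nhdsWithin] with δ hδ
    exact fun h ↦ ha (h ▸ hδ)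

/-- **Uniform form of `KernelTransfer`.** Let `A δ` be sets of loops (the admissible holes at mesh `δ`)
such that every sequence `v_n ∈ A (δ_n)` with `δ_n → 0⁺` has a subsequence converging to a TWO-SIDED
loop.  Then, under `KernelTransfer`, for every `ε > 0`, eventually as `δ → 0⁺` the first-generation laws
of the two closed-b.c. ensembles in `holeOf v` are within `ε` in `d_CN` SIMULTANEOUSLY for all `v ∈ A δ`.
Proof: otherwise pick violators `v_n ∈ A (δ_n)` along a sequence `δ_n → 0⁺`
(`Filter.exists_seq_forall_of_frequently`), pass to a subsequence `v_{φ n} → u` two-sided, and feed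
`KernelTransfer` the family `F δ := v_{φ m}` for the least `m` with `δ_{φ m} = δ` (`F δ := u` off the
sequence): `F → u` as `δ → 0⁺` (the least index of a small `δ` is large), so the discrepancy along
`δ_{φ n}` tends to `0` — but every value of `F` on the sequence is a violator. -/
theorem kernelTransfer_uniform : KernelTransfer → ∀ (A : ℝ → Set (UnbasedLoop ℂ)),
    (∀ (δs : ℕ → ℝ) (vs : ℕ → UnbasedLoop ℂ), Tendsto δs atTop (𝓝[>] 0) →
      (∀ n, vs n ∈ A (δs n)) → ∃ (u : UnbasedLoop ℂ) (φ : ℕ → ℕ), StrictMono φ ∧ TwoSided u ∧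
        Tendsto (vs ∘ φ) atTop (𝓝 u)) →
    ∀ (ε : ℝ), 0 < ε → ∀ᶠ δ in 𝓝[>] (0 : ℝ), ∀ v ∈ A δ,
      LoopConfig.cnLawEDist P2 (fun ω ↦ firstGen (domLoopsZ2 (holeOf v) δ ω)) PT
        (fun ω ↦ firstGen (domLoopsT (holeOf v) δ ω)) ≤ ENNReal.ofReal ε := by
  intro hK A hA ε hε
  classical
  by_contra hcon
  -- violators along a sequence `δs → 0⁺`
  have hfreq : ∃ᶠ δ in 𝓝[>] (0 : ℝ), ∃ v ∈ A δ, ENNReal.ofReal ε <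
      LoopConfig.cnLawEDist P2 (fun ω ↦ firstGen (domLoopsZ2 (holeOf v) δ ω)) PT
        (fun ω ↦ firstGen (domLoopsT (holeOf v) δ ω)) := by
    rw [Filter.not_eventually] at hcon
    refine hcon.mono fun δ hδ ↦ ?_
    push Not at hδ
    exact hδ
  obtain ⟨δs, hδs, hviol⟩ := Filter.exists_seq_forall_of_frequently hfreq
  choose vs hvsA hvs using hviol
  obtain ⟨u, φ, hφ, hu2, hlim⟩ := hA δs vs hδs hvsA
  have hδs' : Tendsto (δs ∘ φ) atTop (𝓝[>] 0) := hδs.comp hφ.tendsto_atTop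
  -- the family fed to `KernelTransfer`
  let F : ℝ → UnbasedLoop ℂ := fun δ ↦ if h : ∃ n, δs (φ n) = δ then vs (φ (Nat.find h)) else u
  have hF : Tendsto F (𝓝[>] 0) (𝓝 u) := by
    rw [Metric.tendsto_nhds]
    intro η hη
    obtain ⟨M, hM⟩ := Metric.tendsto_atTop.1 hlim η hη
    have hev : ∀ᶠ δ in 𝓝[>] (0 : ℝ), ∀ m ∈ Finset.range M, δ ≠ δs (φ m) :=
      (Filter.eventually_all_finset _).2 fun m _ ↦ eventually_nhdsGT_zero_ne _
    filter_upwards [hev] with δ hδ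
    by_cases h : ∃ n, δs (φ n) = δ
    · have hFδ : F δ = vs (φ (Nat.find h)) := by simp only [F, dif_pos h]
      rw [hFδ]
      refine hM (Nat.find h) ?_
      by_contra hlt
      push Not at hlt
      exact hδ (Nat.find h) (Finset.mem_range.2 hlt) (Nat.find_spec h).symm
    · have hFδ : F δ = u := by simp only [F, dif_neg h]
      rw [hFδ, dist_self]
      exact hη
  -- `KernelTransfer` along the family, read on the sequence
  have hT := (hK u F hu2 hF).comp hδs'
  obtain ⟨n, hn⟩ := (hT.eventually (gt_mem_nhds (ENNReal.ofReal_pos.2 hε))).exists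
  have h : ∃ k, δs (φ k) = δs (φ n) := ⟨n, rfl⟩
  set m := Nat.find h with hm
  have hmn : δs (φ m) = δs (φ n) := Nat.find_spec h
  have hFn : F (δs (φ n)) = vs (φ m) := by simp only [F, dif_pos h, hm]
  simp only [Function.comp_apply] at hn
  rw [hFn, ← hmn] at hn
  exact lt_irrefl _ ((hvs (φ m)).trans hn)

end Summit.CriticalPhenomena.CardyFormulaZ2.Cruxes.NestingRigidity.MarkovCascadeOneGeneration

end
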